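import Mathlib.Analysis.Complex.CauchyIntegral
import Mathlib.Analysis.SpecialFunctions.Integrals.Basic
import HarnessLib

/-!
# Fourier coefficients of the Poisson kernel of the unit disc

For `|q| < 1` and `n : ℕ`,

  `∫₀^{2π} e^{inθ} dθ / (1 − 2q cos θ + q²) = 2π qⁿ/(1 − q²)`,

i.e. `∫₀^{2π} cos(nθ)/(1 − 2q cos θ + q²) dθ = 2π qⁿ/(1 − q²)` and `∫₀^{2π} sin(nθ)/(…) dθ = 0`
(`integral_cos_nat_mul_div_poissonDen`, `integral_sin_nat_mul_div_poissonDen`): the cosine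
Fourier coefficients of the Poisson kernel `P_q(θ) = (1 − q²)/(2π(1 − 2q cos θ + q²))` are `qⁿ`.
Proof by the Cauchy integral formula on the unit circle (Mathlib's
`DifferentiableOn.circleIntegral_sub_inv_smul`) applied to `f(z) = zⁿ/(1 − qz)` at the interior
point `q`: on `z = e^{iθ}` one has `(z − q)(1 − qz) = z (1 − 2q cos θ + q²)`.

Consequences used for the Biot–Savart velocity of a mode-two vorticity
(`Literature.Analysis.FluidPDE.BiotSavart2DModeTwo`, towards Gallay–Wayne 2006, Prop. 3.1):

* `integral_sin_two_mul_mul_sin_div_poissonDen`: `∫₀^{2π} sin(2θ) sin θ/(1 − 2q cos θ + q²) dθ = πq`;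
* `integral_sin_two_mul_mul_sin_div_sub_cos_of_lt` (and `_of_gt`): for `0 ≤ ρ < r`,
  `∫_{−π}^{π} sin(2θ) sin θ/(r² + ρ² − 2rρ cos θ) dθ = πρ/r³` (and the symmetric case);
* `integral_cos_two_mul_mul_sin_div_sub_cos`: `∫_{−π}^{π} cos(2θ) sin θ/(r² + ρ² − 2rρ cos θ) dθ = 0`
  (odd integrand).

Everything is proved; no definitions, no named facts. (Classical: the Poisson kernel expansion
`P_q(θ) = (2π)⁻¹(1 + 2∑ qⁿ cos nθ)`; cf. Stein–Shakarchi, *Fourier Analysis*, §2.5.4.)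
-/

noncomputable section

open Real Complex MeasureTheory Set intervalIntegral Metric

namespace Literature.Analysis.SpecialFunctions

/-- `(1 − |q|)² ≤ 1 − 2q cos θ + q²` for all real `q, θ`. [folklore] -/
theorem sq_one_sub_abs_le_poissonDen (q θ : ℝ) : (1 - |q|) ^ 2 ≤ 1 - 2 * q * Real.cos θ + q ^ 2 := by
  have h1 : q * Real.cos θ ≤ |q| := by
    calc q * Real.cos θ ≤ |q * Real.cos θ| := le_abs_self _
      _ = |q| * |Real.cos θ| := abs_mul _ _
      _ ≤ |q| * 1 := by gcongr; exact Real.abs_cos_le_one θ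
      _ = |q| := mul_one _
  nlinarith [sq_abs q]

/-- `0 < 1 − 2q cos θ + q²` for `|q| < 1` and every `θ` (from `(1 − |q|)² ≤ …`). [folklore] -/
theorem poissonDen_pos {q : ℝ} (hq : |q| < 1) : ∀ θ : ℝ, 0 < 1 - 2 * q * Real.cos θ + q ^ 2 := by
  intro θ
  have h2 : 0 < (1 - |q|) ^ 2 := by
    have : 0 < 1 - |q| := by linarith
    positivity
  exact h2.trans_le (sq_one_sub_abs_le_poissonDen q θ)

/-- On the unit circle, `z = e^{iθ}`: `1 − 2q cos θ + q² = (z − q)(1 − qz)/z`. [folklore] -/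
theorem poissonDen_eq_circle (q θ : ℝ) :
    ((1 - 2 * q * Real.cos θ + q ^ 2 : ℝ) : ℂ) =
      (Complex.exp (θ * I) - q) * (1 - q * Complex.exp (θ * I)) / Complex.exp (θ * I) := by
  set u := Complex.exp (θ * I) with hu
  have hu0 : u ≠ 0 := Complex.exp_ne_zero _
  have hcos : Complex.cos (θ : ℂ) = (u + u⁻¹) / 2 := by
    have h2c := Complex.two_cos (θ : ℂ)
    rw [neg_mul, Complex.exp_neg, ← hu] at h2c
    rw [← h2c]
    ring
  push_cast
  rw [hcos]
  field_simp
  ring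

/-- **`∫₀^{2π} e^{inθ}/(1 − 2q cos θ + q²) dθ = 2π qⁿ/(1 − q²)`** for `|q| < 1`, by the Cauchy
integral formula for `zⁿ/(1 − qz)` on the unit circle at the point `q`. [folklore] -/
theorem integral_exp_nat_mul_I_div_poissonDen (n : ℕ) {q : ℝ} (hq : |q| < 1) :
    ∫ θ in (0 : ℝ)..2 * π, Complex.exp (n * θ * I) / ((1 - 2 * q * Real.cos θ + q ^ 2 : ℝ) : ℂ) =
      ((2 * π * q ^ n / (1 - q ^ 2) : ℝ) : ℂ) := by
  set f : ℂ → ℂ := fun z => z ^ n / (1 - q * z) with hf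
  have hden : ∀ z : ℂ, ‖z‖ ≤ 1 → (1 : ℂ) - q * z ≠ 0 := by
    intro z hz h
    have h1 : (q : ℂ) * z = 1 := by linear_combination -h
    have h2 : ‖(q : ℂ) * z‖ < 1 := by
      rw [norm_mul, Complex.norm_real, Real.norm_eq_abs]
      calc |q| * ‖z‖ ≤ |q| * 1 := by gcongr
        _ < 1 := by linarith
    rw [h1, norm_one] at h2
    exact lt_irrefl _ h2
  have hfd : DifferentiableOn ℂ f (closedBall 0 1) := by
    intro z hz
    rw [mem_closedBall_zero_iff] at hz
    apply DifferentiableAt.differentiableWithinAt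
    change DifferentiableAt ℂ (fun z : ℂ => z ^ n / (1 - q * z)) z
    exact DifferentiableAt.div (by fun_prop) (by fun_prop) (hden z hz)
  have hqball : (q : ℂ) ∈ ball (0 : ℂ) 1 := by
    rw [mem_ball_zero_iff, Complex.norm_real, Real.norm_eq_abs]; exact hq
  have hC := hfd.circleIntegral_sub_inv_smul hqball
  rw [circleIntegral] at hC
  have hint : ∫ θ in (0 : ℝ)..2 * π, deriv (circleMap 0 1) θ •
      ((circleMap 0 1 θ - q)⁻¹ • f (circleMap 0 1 θ)) =
      ∫ θ in (0 : ℝ)..2 * π, I * (Complex.exp (n * θ * I) /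
        ((1 - 2 * q * Real.cos θ + q ^ 2 : ℝ) : ℂ)) := by
    refine intervalIntegral.integral_congr fun θ _ => ?_
    simp only [deriv_circleMap, circleMap_zero, hf, smul_eq_mul, Complex.ofReal_one, one_mul]
    rw [poissonDen_eq_circle q θ]
    set u := Complex.exp (θ * I) with hu
    have hu1 : ‖u‖ = 1 := by rw [hu]; exact Complex.norm_exp_ofReal_mul_I θ
    have hu0 : u ≠ 0 := by rw [hu]; exact Complex.exp_ne_zero _
    have hne1 : u - q ≠ 0 := by
      intro h
      have : ‖u‖ = |q| := by
        rw [sub_eq_zero.1 h, Complex.norm_real, Real.norm_eq_abs]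
      rw [hu1] at this
      linarith
    have hne2 : (1 : ℂ) - q * u ≠ 0 := hden u hu1.le
    have hun : Complex.exp (n * θ * I) = u ^ n := by
      rw [hu, ← Complex.exp_nat_mul]; ring_nf
    rw [hun]
    field_simp
  rw [hint, intervalIntegral.integral_const_mul] at hC
  have hfq : f q = q ^ n / (1 - q ^ 2) := by rw [hf]; ring
  rw [hfq, smul_eq_mul] at hC
  have hval : ∫ θ in (0 : ℝ)..2 * π, Complex.exp (n * θ * I) /
      ((1 - 2 * q * Real.cos θ + q ^ 2 : ℝ) : ℂ) = 2 * π * (q ^ n / (1 - q ^ 2)) := by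
    have h := mul_left_cancel₀ I_ne_zero (hC.trans (by ring :
      2 * ↑π * I * ((q : ℂ) ^ n / (1 - (q : ℂ) ^ 2)) = I * (2 * π * (q ^ n / (1 - q ^ 2)))))
    exact h
  rw [hval]
  push_cast
  ring

/-- The integrands `θ ↦ (trig) / (1 − 2q cos θ + q²)` are continuous for `|q| < 1`. [folklore] -/
theorem continuous_div_poissonDen {q : ℝ} (hq : |q| < 1) {g : ℝ → ℝ} (hg : Continuous g) :
    Continuous fun θ : ℝ => g θ / (1 - 2 * q * Real.cos θ + q ^ 2) :=
  hg.div (by fun_prop) fun θ => (poissonDen_pos hq θ).ne'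

/-- **`∫₀^{2π} cos(nθ)/(1 − 2q cos θ + q²) dθ = 2π qⁿ/(1 − q²)`** for `|q| < 1`: the cosine Fourier
coefficients of the Poisson kernel. [folklore] -/
theorem integral_cos_nat_mul_div_poissonDen (n : ℕ) {q : ℝ} (hq : |q| < 1) :
    ∫ θ in (0 : ℝ)..2 * π, Real.cos (n * θ) / (1 - 2 * q * Real.cos θ + q ^ 2) =
      2 * π * q ^ n / (1 - q ^ 2) := by
  have hcont : Continuous fun θ : ℝ => Complex.exp (n * θ * I) /
      ((1 - 2 * q * Real.cos θ + q ^ 2 : ℝ) : ℂ) := by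
    refine Continuous.div (by fun_prop) (by fun_prop) fun θ => ?_
    exact_mod_cast (poissonDen_pos hq θ).ne'
  have h := intervalIntegral_re (hcont.intervalIntegrable 0 (2 * π)) (μ := volume)
  rw [integral_exp_nat_mul_I_div_poissonDen n hq] at h
  simp only [RCLike.re_to_complex, Complex.ofReal_re] at h
  refine Eq.trans (intervalIntegral.integral_congr fun θ _ => ?_) h
  simp only [Complex.div_ofReal_re]
  congr 1
  rw [show (n : ℂ) * θ * I = ((n * θ : ℝ) : ℂ) * I by push_cast; ring, Complex.exp_ofReal_mul_I_re]

/-- `∫₀^{2π} sin(nθ)/(1 − 2q cos θ + q²) dθ = 0` for `|q| < 1`. [folklore] -/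
theorem integral_sin_nat_mul_div_poissonDen (n : ℕ) {q : ℝ} (hq : |q| < 1) :
    ∫ θ in (0 : ℝ)..2 * π, Real.sin (n * θ) / (1 - 2 * q * Real.cos θ + q ^ 2) = 0 := by
  have hcont : Continuous fun θ : ℝ => Complex.exp (n * θ * I) /
      ((1 - 2 * q * Real.cos θ + q ^ 2 : ℝ) : ℂ) := by
    refine Continuous.div (by fun_prop) (by fun_prop) fun θ => ?_
    exact_mod_cast (poissonDen_pos hq θ).ne'
  have h := intervalIntegral_im (hcont.intervalIntegrable 0 (2 * π)) (μ := volume)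
  rw [integral_exp_nat_mul_I_div_poissonDen n hq] at h
  simp only [RCLike.im_to_complex, Complex.ofReal_im] at h
  refine Eq.trans (intervalIntegral.integral_congr fun θ _ => ?_) h
  simp only [Complex.div_ofReal_im]
  congr 1
  rw [show (n : ℂ) * θ * I = ((n * θ : ℝ) : ℂ) * I by push_cast; ring, Complex.exp_ofReal_mul_I_im]

/-- **`∫₀^{2π} sin(2θ) sin θ/(1 − 2q cos θ + q²) dθ = πq`** for `|q| < 1`
(`2 sin 2θ sin θ = cos θ − cos 3θ` and the Poisson coefficients `q`, `q³`). [folklore] -/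
theorem integral_sin_two_mul_mul_sin_div_poissonDen {q : ℝ} (hq : |q| < 1) :
    ∫ θ in (0 : ℝ)..2 * π, Real.sin (2 * θ) * Real.sin θ / (1 - 2 * q * Real.cos θ + q ^ 2) =
      π * q := by
  have hprod : ∀ θ : ℝ, Real.sin (2 * θ) * Real.sin θ =
      (1 / 2) * (Real.cos ((1 : ℕ) * θ) - Real.cos ((3 : ℕ) * θ)) := by
    intro θ
    have h1 : Real.cos ((1 : ℕ) * θ) = Real.cos (2 * θ - θ) := by push_cast; ring_nf
    have h3 : Real.cos ((3 : ℕ) * θ) = Real.cos (2 * θ + θ) := by push_cast; ring_nf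
    rw [h1, h3, Real.cos_sub, Real.cos_add]
    ring
  have hc : ∀ k : ℕ, IntervalIntegrable
      (fun θ => Real.cos (k * θ) / (1 - 2 * q * Real.cos θ + q ^ 2)) volume 0 (2 * π) :=
    fun k => (continuous_div_poissonDen hq (by fun_prop)).intervalIntegrable _ _
  have hfun : (fun θ => Real.sin (2 * θ) * Real.sin θ / (1 - 2 * q * Real.cos θ + q ^ 2)) =
      fun θ => (1 / 2) * (Real.cos ((1 : ℕ) * θ) / (1 - 2 * q * Real.cos θ + q ^ 2) -
        Real.cos ((3 : ℕ) * θ) / (1 - 2 * q * Real.cos θ + q ^ 2)) := by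
    funext θ
    rw [hprod θ]
    ring
  rw [hfun, intervalIntegral.integral_const_mul, intervalIntegral.integral_sub (hc 1) (hc 3),
    integral_cos_nat_mul_div_poissonDen 1 hq, integral_cos_nat_mul_div_poissonDen 3 hq]
  have h1q : 1 - q ^ 2 ≠ 0 := by
    have : q ^ 2 < 1 := by
      have := sq_abs q
      nlinarith [abs_nonneg q]
    linarith
  field_simp

/-- The law of cosines denominator: `r² + ρ² − 2rρ cos θ = r²(1 − 2(ρ/r) cos θ + (ρ/r)²)`. [folklore] -/
theorem sub_cos_den_eq_mul_poissonDen {r : ℝ} (hr : r ≠ 0) (ρ θ : ℝ) :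
    r ^ 2 + ρ ^ 2 - 2 * r * ρ * Real.cos θ =
      r ^ 2 * (1 - 2 * (ρ / r) * Real.cos θ + (ρ / r) ^ 2) := by
  field_simp
  ring

/-- `0 < r² + ρ² − 2rρ cos θ` for `0 ≤ ρ`, `0 < r`, `ρ ≠ r`. [folklore] -/
theorem sub_cos_den_pos {r ρ : ℝ} (hr : 0 < r) (hρ : 0 ≤ ρ) (hne : ρ ≠ r) (θ : ℝ) :
    0 < r ^ 2 + ρ ^ 2 - 2 * r * ρ * Real.cos θ := by
  have h1 : r * ρ * Real.cos θ ≤ r * ρ := by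
    have : Real.cos θ ≤ 1 := Real.cos_le_one θ
    have hrρ : 0 ≤ r * ρ := by positivity
    nlinarith
  have h2 : 0 < (r - ρ) ^ 2 := by
    have : r - ρ ≠ 0 := sub_ne_zero.2 (Ne.symm hne)
    positivity
  nlinarith

/-- **`∫_{−π}^{π} sin(2θ) sin θ/(r² + ρ² − 2rρ cos θ) dθ = πρ/r³`** for `0 ≤ ρ < r`. [folklore] -/
theorem integral_sin_two_mul_mul_sin_div_sub_cos_of_lt {r ρ : ℝ} (hρ : 0 ≤ ρ) (hρr : ρ < r) :
    ∫ θ in (-π)..π, Real.sin (2 * θ) * Real.sin θ / (r ^ 2 + ρ ^ 2 - 2 * r * ρ * Real.cos θ) =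
      π * ρ / r ^ 3 := by
  have hr : 0 < r := hρ.trans_lt hρr
  have hq : |ρ / r| < 1 := by
    rw [abs_of_nonneg (div_nonneg hρ hr.le), div_lt_one hr]
    exact hρr
  set g : ℝ → ℝ := fun θ => Real.sin (2 * θ) * Real.sin θ /
    (1 - 2 * (ρ / r) * Real.cos θ + (ρ / r) ^ 2) with hg
  have hfun : (fun θ => Real.sin (2 * θ) * Real.sin θ / (r ^ 2 + ρ ^ 2 - 2 * r * ρ * Real.cos θ)) =
      fun θ => (r ^ 2)⁻¹ * g θ := by
    funext θ
    rw [hg, sub_cos_den_eq_mul_poissonDen hr.ne' ρ θ]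
    simp only
    rw [mul_comm (r ^ 2), div_mul_eq_div_div, div_eq_inv_mul _ (r ^ 2)]
  have hper : Function.Periodic g (2 * π) := by
    intro θ
    simp only [hg]
    rw [show 2 * (θ + 2 * π) = 2 * θ + ((2 : ℕ) : ℝ) * (2 * π) by push_cast; ring,
      Real.sin_add_nat_mul_two_pi, Real.sin_add_two_pi, Real.cos_add_two_pi]
  have hshift : ∫ θ in (-π)..π, g θ = ∫ θ in (0 : ℝ)..2 * π, g θ := by
    have h := hper.intervalIntegral_add_eq (-π) 0
    rw [show -π + 2 * π = π by ring, zero_add] at h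
    exact h
  rw [hfun, intervalIntegral.integral_const_mul, hshift, hg,
    integral_sin_two_mul_mul_sin_div_poissonDen hq]
  field_simp

/-- **`∫_{−π}^{π} sin(2θ) sin θ/(r² + ρ² − 2rρ cos θ) dθ = πr/ρ³`** for `0 ≤ r < ρ`. [folklore] -/
theorem integral_sin_two_mul_mul_sin_div_sub_cos_of_gt {r ρ : ℝ} (hr : 0 ≤ r) (hrρ : r < ρ) :
    ∫ θ in (-π)..π, Real.sin (2 * θ) * Real.sin θ / (r ^ 2 + ρ ^ 2 - 2 * r * ρ * Real.cos θ) =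
      π * r / ρ ^ 3 := by
  have h := integral_sin_two_mul_mul_sin_div_sub_cos_of_lt hr hrρ
  rw [← h]
  refine intervalIntegral.integral_congr fun θ _ => ?_
  ring_nf

/-- **`∫_{−π}^{π} cos(2θ) sin θ/(r² + ρ² − 2rρ cos θ) dθ = 0`** (odd integrand; no integrability
hypothesis is needed, both sides being junk `0` otherwise). [folklore] -/
theorem integral_cos_two_mul_mul_sin_div_sub_cos (r ρ : ℝ) :
    ∫ θ in (-π)..π, Real.cos (2 * θ) * Real.sin θ / (r ^ 2 + ρ ^ 2 - 2 * r * ρ * Real.cos θ) = 0 := by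
  set g : ℝ → ℝ := fun θ => Real.cos (2 * θ) * Real.sin θ /
    (r ^ 2 + ρ ^ 2 - 2 * r * ρ * Real.cos θ) with hg
  have hodd : ∀ θ, g (-θ) = -g θ := by
    intro θ
    simp only [hg, mul_neg, Real.cos_neg, Real.sin_neg]
    ring
  have h1 : ∫ θ in (-π)..π, g (-θ) = ∫ θ in (-π)..π, g θ := by
    rw [intervalIntegral.integral_comp_neg]
    simp
  simp_rw [hodd, intervalIntegral.integral_neg] at h1
  change ∫ θ in (-π)..π, g θ = 0
  linarith

end Literature.Analysis.SpecialFunctions
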